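import Summits.RiemannHypothesis.RiemannHypothesis.Theorems.JensenPolynomialsFarGumbelCurvature

/-!
# Route `JensenPolynomials`, FAR crux `XiWindowZeroFreeRelFar` (B1-rel far) — S3 WANTED item (L3), part 1a: the MÖBIUS
DISC of `w = (1+z̃)⁻¹` and the algebra of the first-order cancellation (RH-FREE; cell rh-jensen, HUMAN RULING D-0040)

Item `stmt-RiemannHypothesis-19465`, stub S3 `stub_laplaceFar`, WANTED list v3 (HOME `eng-4/S3/S3-WANTED.lean`, sha16
`d6f8107cd04d985a`), item (L3) `wanted_descent`. Generic lemmas used by the saddle-disc dictionary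
(`JensenPolynomialsFarGumbelDescentDisc.lean`) and the descent (`JensenPolynomialsFarGumbelDescent.lean`):

* MÖBIUS DISC `‖w − 625/544‖ ≤ 225/544` for `w = farW z̃ = (1+z̃)⁻¹`, `‖z̃‖ ≤ 9/25` (`norm_farW_sub_center_le`: the image
  of the disc under `z̃ ↦ (1+z̃)⁻¹` has centre `1/(1−r²)` and radius `r/(1−r²)`, `r = 9/25`), whence `Re w ≥ 25/34`,
  `‖w‖ ≤ 25/16`, `‖1/4 − w/2‖ ≤ 17/32` and the COUPLING `Re w ≥ 1/2 + (272/625)‖w‖²` (`farW_disc_facts`), and the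
  polynomial facts `rho_coupling_aux` tying `n = ‖w‖` to `ρₗ(n) = 1/2 + (272/625)n² − (331/10000)n`;
* the ring identity of the FIRST-ORDER CANCELLATION at the approximate saddle `ξ₀ = Log w·(1 + ε(1/4 − w/2))`
  (`cancel_identity_aux`) and its size (`cancel_norm_aux`: `≤ 91/10000`);
* two field identities putting `u_s² + a` and `(2M−1)u_s/(u_s²+a)` in saddle coordinates.

WHAT THIS IS NOT: elementary algebra and inequalities; nothing here bears on the zeros of `ζ` or the truth of RH.
-/

noncomputable section
-- D-0017: `Summit.RiemannHypothesis.RiemannHypothesis.…` duplicates the namespace BY DESIGN (single-problem summit).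
set_option linter.dupNamespace false

namespace Summit.RiemannHypothesis.RiemannHypothesis.Theorems.JensenPolynomials.FarGumbel

open Complex
open scoped Real

/-! ## 1. The Möbius disc of `w = (1+z̃)⁻¹` -/

/-- MÖBIUS DISC: for `‖z‖ ≤ 9/25`, `w = farW z = (1+z)⁻¹` satisfies `‖w − 625/544‖ ≤ 225/544`
(centre `1/(1−r²)`, radius `r/(1−r²)`, `r = 9/25`). -/
theorem norm_farW_sub_center_le {z : ℂ} (hz : ‖z‖ ≤ 9 / 25) :
    ‖farW z - ((625 / 544 : ℝ) : ℂ)‖ ≤ 225 / 544 := by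
  have hzre := abs_le.mp (Complex.abs_re_le_norm z)
  have h1z : 1 + z ≠ 0 := by
    intro h
    have h' : (1 + z).re = 0 := by rw [h]; simp
    simp at h'
    linarith [hzre.1]
  have e : farW z - ((625 / 544 : ℝ) : ℂ) = -(81 + 625 * z) / (544 * (1 + z)) := by
    rw [farW]
    push_cast
    field_simp
    ring
  have h544 : ‖(544 : ℂ)‖ = 544 := by simp
  rw [e, norm_div, norm_neg, norm_mul, h544, div_le_div_iff₀ (by positivity) (by norm_num)]
  have hsq : ‖81 + 625 * z‖ ^ 2 ≤ (225 * ‖1 + z‖) ^ 2 := by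
    rw [mul_pow, Complex.sq_norm, Complex.sq_norm, Complex.normSq_apply, Complex.normSq_apply]
    have hz2 : z.re * z.re + z.im * z.im ≤ (9 / 25) ^ 2 := by
      have h1 : ‖z‖ ^ 2 = z.re * z.re + z.im * z.im := by rw [Complex.sq_norm, Complex.normSq_apply]
      rw [← h1]
      exact pow_le_pow_left₀ (norm_nonneg z) hz 2
    simp [Complex.mul_re, Complex.mul_im]
    nlinarith [hz2]
  have h := (pow_le_pow_iff_left₀ (norm_nonneg _) (by positivity) two_ne_zero).mp hsq
  nlinarith [h, norm_nonneg (1 + z)]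

/-- Consequences of the Möbius disc for `w = farW z`, `‖z‖ ≤ 9/25`: `Re w ≥ 25/34`, `‖w‖ ≤ 25/16`,
`‖1/4 − w/2‖ ≤ 17/32`, and the COUPLING `Re w ≥ 1/2 + (272/625)‖w‖²`. -/
theorem farW_disc_facts {z : ℂ} (hz : ‖z‖ ≤ 9 / 25) :
    25 / 34 ≤ (farW z).re ∧ ‖farW z‖ ≤ 25 / 16 ∧ ‖(1 / 4 : ℂ) - farW z / 2‖ ≤ 17 / 32 ∧
      1 / 2 + 272 / 625 * ‖farW z‖ ^ 2 ≤ (farW z).re := by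
  have h := norm_farW_sub_center_le hz
  set w := farW z with hw
  have hc : ‖((625 / 544 : ℝ) : ℂ)‖ = 625 / 544 := by
    rw [Complex.norm_real, Real.norm_of_nonneg (by norm_num)]
  refine ⟨?_, ?_, ?_, ?_⟩
  · have h1 := (abs_le.mp (Complex.abs_re_le_norm (w - ((625 / 544 : ℝ) : ℂ)))).1
    simp only [Complex.sub_re, Complex.ofReal_re] at h1
    linarith
  · calc ‖w‖ = ‖(w - ((625 / 544 : ℝ) : ℂ)) + ((625 / 544 : ℝ) : ℂ)‖ := by rw [sub_add_cancel]
      _ ≤ ‖w - ((625 / 544 : ℝ) : ℂ)‖ + ‖((625 / 544 : ℝ) : ℂ)‖ := norm_add_le _ _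
      _ ≤ 225 / 544 + 625 / 544 := by rw [hc]; linarith
      _ = 25 / 16 := by norm_num
  · have e : (1 / 4 : ℂ) - w / 2 =
        ((-1 / 2 : ℝ) : ℂ) * (w - ((625 / 544 : ℝ) : ℂ)) + ((-353 / 1088 : ℝ) : ℂ) := by
      push_cast
      ring
    have hc2 : ‖((-353 / 1088 : ℝ) : ℂ)‖ = 353 / 1088 := by
      rw [Complex.norm_real, Real.norm_eq_abs]; norm_num
    have hc3 : ‖((-1 / 2 : ℝ) : ℂ)‖ = 1 / 2 := by
      rw [Complex.norm_real, Real.norm_eq_abs]; norm_num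
    rw [e]
    calc ‖((-1 / 2 : ℝ) : ℂ) * (w - ((625 / 544 : ℝ) : ℂ)) + ((-353 / 1088 : ℝ) : ℂ)‖
        ≤ ‖((-1 / 2 : ℝ) : ℂ) * (w - ((625 / 544 : ℝ) : ℂ))‖ + ‖((-353 / 1088 : ℝ) : ℂ)‖ := norm_add_le _ _
      _ = 1 / 2 * ‖w - ((625 / 544 : ℝ) : ℂ)‖ + 353 / 1088 := by rw [norm_mul, hc3, hc2]
      _ ≤ 1 / 2 * (225 / 544) + 353 / 1088 := by gcongr
      _ = 17 / 32 := by norm_num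
  · have h2 : ‖w - ((625 / 544 : ℝ) : ℂ)‖ ^ 2 ≤ (225 / 544) ^ 2 := pow_le_pow_left₀ (norm_nonneg _) h 2
    rw [Complex.sq_norm, Complex.normSq_apply] at h2
    simp only [Complex.sub_re, Complex.ofReal_re, Complex.sub_im, Complex.ofReal_im, sub_zero] at h2
    have h3 : ‖w‖ ^ 2 = w.re * w.re + w.im * w.im := by rw [Complex.sq_norm, Complex.normSq_apply]
    rw [h3]
    nlinarith [h2]

/-- Polynomial facts coupling `n = ‖w‖ ∈ [25/34, 25/16]` with the `ρ`-lower bound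
`ρₗ(n) = 1/2 + (272/625)n² − (331/10000)n`: `ρₗ ≥ 71/100`, `n ≤ (28/25)ρₗ`, `n² ≤ (163/100)ρₗ`. -/
theorem rho_coupling_aux {n : ℝ} (h1 : 25 / 34 ≤ n) (h2 : n ≤ 25 / 16) :
    71 / 100 ≤ 1 / 2 + 272 / 625 * n ^ 2 - 331 / 10000 * n ∧
    n ≤ 28 / 25 * (1 / 2 + 272 / 625 * n ^ 2 - 331 / 10000 * n) ∧
    n ^ 2 ≤ 163 / 100 * (1 / 2 + 272 / 625 * n ^ 2 - 331 / 10000 * n) := by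
  have hn0 : 0 ≤ n := by linarith
  refine ⟨?_, ?_, ?_⟩
  · nlinarith [mul_nonneg (sub_nonneg.2 h1) hn0]
  · nlinarith [sq_nonneg (n - 10638 / 10000)]
  · nlinarith [mul_nonneg hn0 (sub_nonneg.2 h2)]

/-! ## 2. The first-order cancellation: algebra and sizes -/

/-- The algebra of the first-order cancellation at `ξ₀` (pure ring identity): with `θ = Lεm`, `m = 1/4 − w/2`,
`κ = θ + 4d`, `ξ = L + κ`, `σ = w(εξ/2 + ε²ξ²/16)`,
`(1 + εξ/4) − (1+σ)(1 + κ + E₂) = θ·εm − 4d(1 − εm) − wε²ξ²/16 − σκ − (1+σ)E₂`. -/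
theorem cancel_identity_aux (L m d w E₂ ε κ : ℂ) (hm : m = 1 / 4 - w / 2) (hκ : κ = L * (ε * m) + 4 * d) :
    (1 + ε * (L + κ) / 4) - (1 + w * (ε * (L + κ) / 2 + ε ^ 2 * (L + κ) ^ 2 / 16)) * (1 + κ + E₂) =
      L * (ε * m) * (ε * m) - 4 * d * (1 - ε * m) - w * (ε ^ 2 * (L + κ) ^ 2 / 16)
        - w * (ε * (L + κ) / 2 + ε ^ 2 * (L + κ) ^ 2 / 16) * κ
        - (1 + w * (ε * (L + κ) / 2 + ε ^ 2 * (L + κ) ^ 2 / 16)) * E₂ := by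
  subst hκ hm
  ring

/-- Norm bookkeeping for the cancellation numerator: with the disc sizes
`‖θ‖ ≤ 27/1000`, `‖m‖ ≤ 17/32`, `‖d‖ ≤ 1/890`, `‖w‖ ≤ 25/16`, `‖ξ‖ ≤ 1/2`, `‖σ‖ ≤ 21/500`, `‖κ‖ ≤ 4/125`,
`‖E₂‖ ≤ 16/15625`, `0 ≤ ε ≤ 20/189`, the numerator has norm `≤ 91/10000`. -/
theorem cancel_norm_aux {θ m d w ξ σ κ E₂ : ℂ} {ε : ℝ} (hε0 : 0 ≤ ε) (hε : ε ≤ 20 / 189)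
    (hθ : ‖θ‖ ≤ 27 / 1000) (hm : ‖m‖ ≤ 17 / 32) (hd : ‖d‖ ≤ 1 / 890) (hw : ‖w‖ ≤ 25 / 16)
    (hξ : ‖ξ‖ ≤ 1 / 2) (hσ : ‖σ‖ ≤ 21 / 500) (hκ : ‖κ‖ ≤ 4 / 125) (hE : ‖E₂‖ ≤ 16 / 15625) :
    ‖θ * ((ε : ℂ) * m) - 4 * d * (1 - (ε : ℂ) * m) - w * ((ε : ℂ) ^ 2 * ξ ^ 2 / 16)
      - σ * κ - (1 + σ) * E₂‖ ≤ 91 / 10000 := by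
  have hεn : ‖(ε : ℂ)‖ = ε := by rw [Complex.norm_real, Real.norm_of_nonneg hε0]
  have e4 : ‖(4 : ℂ)‖ = 4 := by simp
  have e16 : ‖(16 : ℂ)‖ = 16 := by simp
  have t1 : ‖θ * ((ε : ℂ) * m)‖ ≤ 27 / 1000 * (20 / 189 * (17 / 32)) := by
    rw [norm_mul, norm_mul, hεn]
    gcongr
  have t2 : ‖4 * d * (1 - (ε : ℂ) * m)‖ ≤ 4 * (1 / 890) * (1 + 20 / 189 * (17 / 32)) := by
    rw [norm_mul, norm_mul, e4]
    have h1 : ‖1 - (ε : ℂ) * m‖ ≤ 1 + 20 / 189 * (17 / 32) := by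
      calc ‖1 - (ε : ℂ) * m‖ ≤ ‖(1 : ℂ)‖ + ‖(ε : ℂ) * m‖ := norm_sub_le _ _
        _ = 1 + ε * ‖m‖ := by rw [norm_one, norm_mul, hεn]
        _ ≤ 1 + 20 / 189 * (17 / 32) := by gcongr
    gcongr
  have t3 : ‖w * ((ε : ℂ) ^ 2 * ξ ^ 2 / 16)‖ ≤ 25 / 16 * ((20 / 189) ^ 2 * (1 / 2) ^ 2 / 16) := by
    rw [norm_mul, norm_div, norm_mul, norm_pow, norm_pow, hεn, e16]
    gcongr
  have t4 : ‖σ * κ‖ ≤ 21 / 500 * (4 / 125) := by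
    rw [norm_mul]
    gcongr
  have h1σ' : ‖1 + σ‖ ≤ 521 / 500 := by
    calc ‖1 + σ‖ ≤ ‖(1 : ℂ)‖ + ‖σ‖ := norm_add_le _ _
      _ ≤ 1 + 21 / 500 := by rw [norm_one]; linarith
      _ = 521 / 500 := by norm_num
  have t5 : ‖(1 + σ) * E₂‖ ≤ 521 / 500 * (16 / 15625) := by
    rw [norm_mul]
    gcongr
  have s1 := norm_sub_le (θ * ((ε : ℂ) * m) - 4 * d * (1 - (ε : ℂ) * m) - w * ((ε : ℂ) ^ 2 * ξ ^ 2 / 16)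
    - σ * κ) ((1 + σ) * E₂)
  have s2 := norm_sub_le (θ * ((ε : ℂ) * m) - 4 * d * (1 - (ε : ℂ) * m) - w * ((ε : ℂ) ^ 2 * ξ ^ 2 / 16))
    (σ * κ)
  have s3 := norm_sub_le (θ * ((ε : ℂ) * m) - 4 * d * (1 - (ε : ℂ) * m)) (w * ((ε : ℂ) ^ 2 * ξ ^ 2 / 16))
  have s4 := norm_sub_le (θ * ((ε : ℂ) * m)) (4 * d * (1 - (ε : ℂ) * m))
  linarith [s1, s2, s3, s4, t1, t2, t3, t4, t5]

/-- `u_s² + a` in saddle coordinates (pure field identity): with `u_s = υ + ξ/4`, `a = z̃υ²`, `w = (1+z̃)⁻¹`, `ε = υ⁻¹`,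
`u_s² + a = υ²(1+z̃)(1 + w(εξ/2 + ε²ξ²/16))`. -/
theorem sq_add_identity_aux (υ ξ z : ℂ) (hυ : υ ≠ 0) (h1z : 1 + z ≠ 0) :
    (υ + ξ / 4) ^ 2 + z * υ ^ 2 =
      υ ^ 2 * (1 + z) * (1 + (1 + z)⁻¹ * (υ⁻¹ * ξ / 2 + υ⁻¹ ^ 2 * ξ ^ 2 / 16)) := by
  field_simp
  ring

/-- `(2M−1)u_s/(u_s²+a)` in saddle coordinates (pure field identity): with `2M − 1 = υ·c`,
`υ·c·(υ + ξ/4)/(υ²(1+z̃)(1+σ)) = c·(1 + εξ/4)·w/(1+σ)`. -/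
theorem lin_identity_aux (υ ξ z σ c : ℂ) (hυ : υ ≠ 0) (h1z : 1 + z ≠ 0) (h1σ : 1 + σ ≠ 0) :
    υ * c * (υ + ξ / 4) / (υ ^ 2 * (1 + z) * (1 + σ)) = c * ((1 + υ⁻¹ * ξ / 4) * (1 + z)⁻¹ / (1 + σ)) := by
  field_simp

end Summit.RiemannHypothesis.RiemannHypothesis.Theorems.JensenPolynomials.FarGumbel

end
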